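import Literature.Analysis.FluidPDE.FiniteFourierModeEulerCollinear
import Literature.Analysis.FluidPDE.FiniteFourierModeEulerFace
import Literature.Analysis.FluidPDE.FiniteFourierModeEulerSkeleton

/-!
# Kishimoto–Yoneda, §4 Lemma 4.5: the points of an edge do not interact

Support file for `FiniteFourierModeEuler` (N. Kishimoto, T. Yoneda, J. Math. Fluid Mech. 24
(2022) 74 = arXiv:2110.08039). **Lemma 4.5**: for an edge `E` of `S^{conv}` (an exposed collinear
subset `E ∩ S = {n₁, n₂, …, n_p}` of `S`, listed along the edge), (i) if `p = 2` the endpoints are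
simply interacting, hence do not interact; (ii) if `p ≥ 3` then all coefficient vectors on `E` are
perpendicular to the plane through `E` and the origin and any two of them do not interact — by
induction along the edge: `(n₁, n₂)` and `(n₁, n₃)` are simply interacting, three collinear points
cannot have equal lengths, so Prop. 2.2 forces case (ii) (normal vectors), and for `q ≥ 4` the
competitors of `(n₁, n_q)` are pairs of inner points, which do not interact by the induction
hypothesis. We prove this at a fixed time `t` at which every mode of `S` is occupied
(`nonInteracting_endpoint_of_exposed_ray`), in the parametrisation `n₁ + θ e`, `θ ≥ 0`, of the
exposed ray used in `FiniteFourierModeEulerSkeleton`.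

## References

* [KishimotoYoneda2022] N. Kishimoto, T. Yoneda, J. Math. Fluid Mech. 24 (2022) 74 =
  arXiv:2110.08039, §4 Lemma 4.5 and its proof.
-/

noncomputable section

open Matrix

namespace Literature.Analysis.FluidPDE

namespace KY

/-! ### Normal vectors on a line -/

/-- A vector `u` at a point of the line `n₁ + ℝ e` is *normal* if it is a multiple of
`k = n₁ × e`, the normal of the plane through the line and the origin (case (ii) of Prop. 2.2).
[cite: KishimotoYoneda2022, §4 Lemma 4.5 (ii)] -/
def IsNormalTo (k : Fin 3 → ℝ) (u : Fin 3 → ℂ) : Prop := ∃ β : ℂ, u = β • cplx k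

/-- Two points of the line `n₁ + ℝe` have cross product a multiple of `k = n₁ × e`. [folklore] -/
theorem cross_on_line (n₁ e : Fin 3 → ℝ) (θ θ' : ℝ) :
    (n₁ + θ • e) ⨯₃ (n₁ + θ' • e) = (θ' - θ) • (n₁ ⨯₃ e) := by
  ext i
  fin_cases i <;> simp [cross_apply] <;> ring

/-- Normal vectors at two distinct points of a line not through the origin do not interact
(Prop. 2.2 (ii)). [cite: KishimotoYoneda2022, §2 Prop. 2.2 (ii), §4 Lemma 4.5 (ii)] -/
theorem nonInteracting_of_isNormalTo {n₁ e : Fin 3 → ℝ} (hk : n₁ ⨯₃ e ≠ 0) {θ θ' : ℝ} (hθ : θ ≠ θ')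
    {uc ue : Fin 3 → ℂ} (hc : IsNormalTo (n₁ ⨯₃ e) uc) (he : IsNormalTo (n₁ ⨯₃ e) ue) :
    NonInteracting (n₁ + θ • e) (n₁ + θ' • e) uc ue := by
  obtain ⟨βc, rfl⟩ := hc
  obtain ⟨βe, rfl⟩ := he
  have hkk : (n₁ + θ • e) ⨯₃ (n₁ + θ' • e) ≠ 0 := by
    rw [cross_on_line]; exact smul_ne_zero (sub_ne_zero.2 (Ne.symm hθ)) hk
  have hd : (θ' - θ : ℂ) ≠ 0 := by exact_mod_cast sub_ne_zero.2 (Ne.symm hθ)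
  have h1 : βc • cplx (n₁ ⨯₃ e) = (βc / (θ' - θ : ℂ)) • cplx ((n₁ + θ • e) ⨯₃ (n₁ + θ' • e)) := by
    rw [cross_on_line, cplx_smul, smul_smul]; push_cast; rw [div_mul_cancel₀ _ hd]
  have h2 : βe • cplx (n₁ ⨯₃ e) = (βe / (θ' - θ : ℂ)) • cplx ((n₁ + θ • e) ⨯₃ (n₁ + θ' • e)) := by
    rw [cross_on_line, cplx_smul, smul_smul]; push_cast; rw [div_mul_cancel₀ _ hd]
  rw [h1, h2]
  exact nonInteracting_of_normal hkk _ _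

/-- Transport of normality (Prop. 2.2): if `u₁` at `n₁` is normal and `(n₁, n₁ + θe)` does not
interact (`θ ≠ 0`, both vectors non-zero and divergence-free), then the vector at `n₁ + θe` is
normal as well. [cite: KishimotoYoneda2022, §2 Prop. 2.2, §4 Lemma 4.5 (ii)] -/
theorem IsNormalTo.transport {n₁ e : Fin 3 → ℝ} (hk : n₁ ⨯₃ e ≠ 0) {θ : ℝ} (hθ : θ ≠ 0)
    {u₁ u₂ : Fin 3 → ℂ} (h₁ : IsNormalTo (n₁ ⨯₃ e) u₁) (hne₁ : u₁ ≠ 0) (hne₂ : u₂ ≠ 0)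
    (hdiv₂ : dot (cplx (n₁ + θ • e)) u₂ = 0)
    (hNI : NonInteracting n₁ (n₁ + θ • e) u₁ u₂) : IsNormalTo (n₁ ⨯₃ e) u₂ := by
  have hkk : n₁ ⨯₃ (n₁ + θ • e) ≠ 0 := by
    rw [cross_self_add_smul]; exact smul_ne_zero hθ hk
  obtain ⟨β₁, rfl⟩ := h₁
  have hu₁ : β₁ • cplx (n₁ ⨯₃ e) = (0 : ℂ) • cplx ((n₁ ⨯₃ (n₁ + θ • e)) ⨯₃ n₁)
      + (β₁ / (θ : ℂ)) • cplx (n₁ ⨯₃ (n₁ + θ • e)) := by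
    rw [cross_self_add_smul, cplx_smul, zero_smul, zero_add, smul_smul, div_mul_cancel₀]
    exact_mod_cast hθ
  obtain ⟨α₂, β₂, hu₂⟩ := exists_frame₂ hkk hdiv₂
  obtain ⟨⟨γ, -, hα, -⟩, -⟩ := nonInteracting_transport hkk hu₁ hu₂ hne₁ hne₂ hNI
  rw [mul_zero] at hα
  refine ⟨β₂ * θ, ?_⟩
  rw [hu₂, hα, zero_smul, zero_add, cross_self_add_smul, cplx_smul, smul_smul]

/-- A normal vector at `n₁` for the frame of the pair `(n₁, n₁ + θe)` has vanishing first frame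
coordinate; conversely if the first coordinate is non-zero the pair has equal lengths
(Prop. 2.2 (iii)). We record: if `u₁` is NOT normal then `|n₁ + θe| = |n₁|`.
[cite: KishimotoYoneda2022, §2 Prop. 2.2, §4 Lemma 4.5 (ii)] -/
theorem dot_self_eq_of_not_isNormalTo {n₁ e : Fin 3 → ℝ} (hk : n₁ ⨯₃ e ≠ 0) {θ : ℝ} (hθ : θ ≠ 0)
    {u₁ u₂ : Fin 3 → ℂ} (h₁ : ¬ IsNormalTo (n₁ ⨯₃ e) u₁) (hdiv₁ : dot (cplx n₁) u₁ = 0)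
    (hne₁ : u₁ ≠ 0) (hne₂ : u₂ ≠ 0) (hdiv₂ : dot (cplx (n₁ + θ • e)) u₂ = 0)
    (hNI : NonInteracting n₁ (n₁ + θ • e) u₁ u₂) :
    (n₁ + θ • e) ⬝ᵥ (n₁ + θ • e) = n₁ ⬝ᵥ n₁ := by
  have hkk : n₁ ⨯₃ (n₁ + θ • e) ≠ 0 := by
    rw [cross_self_add_smul]; exact smul_ne_zero hθ hk
  obtain ⟨α₁, β₁, hu₁⟩ := exists_frame₁ hkk hdiv₁
  obtain ⟨α₂, β₂, hu₂⟩ := exists_frame₂ hkk hdiv₂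
  obtain ⟨-, hnorm⟩ := nonInteracting_transport hkk hu₁ hu₂ hne₁ hne₂ hNI
  have hα₁ : α₁ ≠ 0 := by
    intro h0
    apply h₁
    refine ⟨β₁ * θ, ?_⟩
    rw [hu₁, h0, zero_smul, zero_add, cross_self_add_smul, cplx_smul, smul_smul]
  exact (hnorm hα₁).symm

/-! ### Lemma 4.5 along an exposed ray -/

namespace IsFiniteModeEulerSolution

variable {I : Set ℝ} {S : Finset (Fin 3 → ℝ)} {u : (Fin 3 → ℝ) → ℝ → (Fin 3 → ℂ)}

/-- **Lemma 4.5.** Let `ψ` expose in `S` a set of points of the ray `n₁ + θe` (`θ ≥ 0`,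
`ψ·e = 0`, `ψ·n₁ > 0` the maximal value), and let every mode of `S` be occupied at the time
`t ∈ I`. Then `n₁` does not interact with any other exposed point `n₁ + θe ∈ S`, `θ > 0`; moreover,
if there are at least two such points, all the coefficient vectors on the ray (including `u_{n₁}`)
are normal to the plane through the ray and the origin.
[cite: KishimotoYoneda2022, §4 Lemma 4.5 (i), (ii)] -/
theorem nonInteracting_endpoint_of_exposed_ray (hS : IsFiniteModeEulerSolution I S u) {t : ℝ}
    (ht : t ∈ I) (hgen : ∀ n ∈ S, u n t ≠ 0) {ψ n₁ e : Fin 3 → ℝ} (h₁ : n₁ ∈ S)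
    (hM : 0 < ψ ⬝ᵥ n₁) (hmax : ∀ s ∈ S, ψ ⬝ᵥ s ≤ ψ ⬝ᵥ n₁)
    (hray : ∀ s ∈ S, ψ ⬝ᵥ s = ψ ⬝ᵥ n₁ → ∃ θ : ℝ, 0 ≤ θ ∧ s = n₁ + θ • e)
    (he : ψ ⬝ᵥ e = 0) (hk : n₁ ⨯₃ e ≠ 0) {θ : ℝ} (hθ : 0 < θ) (hp : n₁ + θ • e ∈ S) :
    NonInteracting n₁ (n₁ + θ • e) (u n₁ t) (u (n₁ + θ • e) t) := by
  classical
  have he0 : e ≠ 0 := by rintro rfl; exact hk (by simp)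
  have hψe : ∀ θ : ℝ, ψ ⬝ᵥ (n₁ + θ • e) = ψ ⬝ᵥ n₁ := fun θ => by
    rw [dotProduct_add, dotProduct_smul, he, smul_zero, add_zero]
  have hinj : ∀ θ θ' : ℝ, n₁ + θ • e = n₁ + θ' • e → θ = θ' := by
    intro θ θ' h
    have : (θ - θ') • e = 0 := by rw [sub_smul, sub_eq_zero]; exact add_left_cancel h
    exact sub_eq_zero.1 ((smul_eq_zero.1 this).resolve_right he0)
  -- positive parameters of points of `S` on the ray
  let Θ : Set ℝ := {θ' : ℝ | 0 < θ' ∧ n₁ + θ' • e ∈ S}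
  have hΘfin : Θ.Finite := by
    apply Set.Finite.of_finite_image (f := fun θ' => n₁ + θ' • e)
    · exact (S.finite_toSet).subset (by rintro _ ⟨θ', hθ', rfl⟩; exact hθ'.2)
    · intro a _ b _ hab; exact hinj a b hab
  -- competitors of `(n₁, n₁ + θ'e)` are pairs of points of the ray with parameters summing to `θ'`
  have hcomp : ∀ θ' : ℝ, 0 < θ' → ∀ c ∈ S, ∀ d ∈ S, c + d = n₁ + (n₁ + θ' • e) →
      ∃ θc θd : ℝ, 0 ≤ θc ∧ 0 ≤ θd ∧ c = n₁ + θc • e ∧ d = n₁ + θd • e ∧ θc + θd = θ' := by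
    intro θ' hθ' c hc d hd hsum
    have hs : ψ ⬝ᵥ c + ψ ⬝ᵥ d = 2 * ψ ⬝ᵥ n₁ := by
      rw [← dotProduct_add, hsum, dotProduct_add, hψe]; ring
    have ec : ψ ⬝ᵥ c = ψ ⬝ᵥ n₁ := le_antisymm (hmax _ hc) (by linarith [hmax _ hd])
    have ed : ψ ⬝ᵥ d = ψ ⬝ᵥ n₁ := by linarith
    obtain ⟨θc, hθc, rfl⟩ := hray c hc ec
    obtain ⟨θd, hθd, rfl⟩ := hray d hd ed
    refine ⟨θc, θd, hθc, hθd, rfl, rfl, ?_⟩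
    have : n₁ + (n₁ + (θc + θd) • e) = n₁ + (n₁ + θ' • e) := by rw [← hsum, add_smul]; abel
    exact hinj _ _ (add_left_cancel this)
  have hnotsum : ∀ θ' : ℝ, 0 < θ' → n₁ + (n₁ + θ' • e) ∉ S := by
    intro θ' _ hmem
    have := hmax _ hmem
    rw [dotProduct_add, hψe] at this
    linarith
  -- Case distinction: is `θ` the only positive parameter?
  by_cases hone : ∀ θ' ∈ Θ, θ' = θ
  · -- p = 2: simply interacting
    have hfirst : ∀ θ' : ℝ, 0 < θ' → n₁ + θ' • e ∈ S → θ ≤ θ' :=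
      fun θ' h1 h2 => (hone θ' ⟨h1, h2⟩).ge
    obtain ⟨hsum, huniq⟩ := sip_endpoint_next hM hmax hray he he0 hfirst
    have hne : n₁ ≠ n₁ + θ • e := by
      intro h; have := hinj 0 θ (by simpa using h); linarith
    exact hS.nonInteracting_of_sip h₁ hp hne hsum huniq ht
  · -- p ≥ 3: everything on the ray is normal; strong induction on the parameter
    push Not at hone
    obtain ⟨θ₀, hθ₀Θ, hθ₀ne⟩ := hone
    -- Step 1: `u_{n₁}` is normal.
    have hn₁normal : IsNormalTo (n₁ ⨯₃ e) (u n₁ t) := by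
      by_contra hnn
      -- the two smallest positive parameters give two SIP partners of equal length
      obtain ⟨θ₂, hθ₂Θ, hθ₂min⟩ := Set.Finite.exists_minimal hΘfin ⟨θ, hθ, hp⟩
      have hΘ' : (Θ \ {θ₂}).Nonempty := by
        by_cases h : θ₂ = θ
        · exact ⟨θ₀, hθ₀Θ, by rw [Set.mem_singleton_iff, h]; exact hθ₀ne⟩
        · exact ⟨θ, ⟨hθ, hp⟩, by rw [Set.mem_singleton_iff]; exact Ne.symm h⟩
      obtain ⟨θ₃, hθ₃Θ', hθ₃min⟩ := Set.Finite.exists_minimal (hΘfin.subset fun x hx => hx.1) hΘ'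
      have hθ₃Θ : θ₃ ∈ Θ := hθ₃Θ'.1
      have hθ₃ne : θ₃ ≠ θ₂ := fun h => hθ₃Θ'.2 h
      have hfirst : ∀ θ' : ℝ, 0 < θ' → n₁ + θ' • e ∈ S → θ₂ ≤ θ' := by
        intro θ' h1 h2
        by_contra hlt; rw [not_le] at hlt
        exact absurd (hθ₂min ⟨h1, h2⟩ hlt.le) (not_le.2 hlt)
      have hsecond : ∀ θ' : ℝ, 0 < θ' → θ' ≠ θ₂ → n₁ + θ' • e ∈ S → θ₃ ≤ θ' := by
        intro θ' h1 h2 h3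
        by_contra hlt; rw [not_le] at hlt
        exact absurd (hθ₃min ⟨⟨h1, h3⟩, h2⟩ hlt.le) (not_le.2 hlt)
      obtain ⟨hsum₂, huniq₂⟩ := sip_endpoint_next hM hmax hray he he0 hfirst
      obtain ⟨hsum₃, huniq₃⟩ := sip_endpoint_second hM hmax hray he he0 hsecond
      have hne₂ : n₁ ≠ n₁ + θ₂ • e := by
        intro h; have := hinj 0 θ₂ (by simpa using h); linarith [hθ₂Θ.1]
      have hne₃ : n₁ ≠ n₁ + θ₃ • e := by
        intro h; have := hinj 0 θ₃ (by simpa using h); linarith [hθ₃Θ.1]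
      have hNI₂ := hS.nonInteracting_of_sip h₁ hθ₂Θ.2 hne₂ hsum₂ huniq₂ ht
      have hNI₃ := hS.nonInteracting_of_sip h₁ hθ₃Θ.2 hne₃ hsum₃ huniq₃ ht
      have hl₂ := dot_self_eq_of_not_isNormalTo hk hθ₂Θ.1.ne' hnn (hS.div_free n₁ h₁ t ht)
        (hgen n₁ h₁) (hgen _ hθ₂Θ.2) (hS.div_free _ hθ₂Θ.2 t ht) hNI₂
      have hl₃ := dot_self_eq_of_not_isNormalTo hk hθ₃Θ.1.ne' hnn (hS.div_free n₁ h₁ t ht)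
        (hgen n₁ h₁) (hgen _ hθ₃Θ.2) (hS.div_free _ hθ₃Θ.2 t ht) hNI₃
      exact hθ₃ne.symm (eq_of_dot_self_eq_on_ray he0 hθ₂Θ.1.ne' hθ₃Θ.1.ne' hl₂ hl₃)
    -- Step 2: strong induction: every point of the ray is NI with `n₁` and normal.
    have hall : ∀ θ' ∈ Θ, NonInteracting n₁ (n₁ + θ' • e) (u n₁ t) (u (n₁ + θ' • e) t)
        ∧ IsNormalTo (n₁ ⨯₃ e) (u (n₁ + θ' • e) t) := by
      by_contra hbad
      push Not at hbad
      let B : Set ℝ := {θ' : ℝ | θ' ∈ Θ ∧ ¬ (NonInteracting n₁ (n₁ + θ' • e) (u n₁ t) (u (n₁ + θ' • e) t)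
        ∧ IsNormalTo (n₁ ⨯₃ e) (u (n₁ + θ' • e) t))}
      obtain ⟨θb, hθb, hb⟩ := hbad
      have hBfin : B.Finite := hΘfin.subset (fun x (hx : x ∈ B) => hx.1)
      have hBne : B.Nonempty := ⟨θb, show θb ∈ B from ⟨hθb, fun h => hb h.1 h.2⟩⟩
      obtain ⟨θm, hθmB, hθmmin⟩ := Set.Finite.exists_minimal hBfin hBne
      have hθmΘ : θm ∈ Θ := hθmB.1
      apply hθmB.2
      -- all smaller parameters are good
      have hgood : ∀ θ' ∈ Θ, θ' < θm → IsNormalTo (n₁ ⨯₃ e) (u (n₁ + θ' • e) t) := by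
        intro θ' hθ' hlt
        by_contra hng
        have hB : θ' ∈ B := show θ' ∈ B from ⟨hθ', fun h => hng h.2⟩
        exact absurd (hθmmin hB hlt.le) (not_le.2 hlt)
      -- NI via cancellation at `n₁ + (n₁ + θm e)`
      have hne : n₁ ≠ n₁ + θm • e := by
        intro h; have := hinj 0 θm (by simpa using h); linarith [hθmΘ.1]
      have hNI : NonInteracting n₁ (n₁ + θm • e) (u n₁ t) (u (n₁ + θm • e) t) := by
        apply hS.nonInteracting_of_others_vanish h₁ hθmΘ.2 hne (hnotsum θm hθmΘ.1) ht
        intro c hc d hd hcd hsum hn1 hn2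
        obtain ⟨θc, θd, hθc, hθd, rfl, rfl, hcdsum⟩ := hcomp θm hθmΘ.1 c hc d hd hsum
        -- both parameters are positive (else it is the pair itself) hence `< θm`
        have hθc0 : θc ≠ 0 := by
          rintro rfl
          apply hn1
          refine ⟨by simp, ?_⟩
          rw [show θd = θm by linarith]
        have hθd0 : θd ≠ 0 := by
          rintro rfl
          apply hn2
          refine ⟨?_, by simp⟩
          rw [show θc = θm by linarith]
        have hθcpos : 0 < θc := lt_of_le_of_ne hθc (Ne.symm hθc0)
        have hθdpos : 0 < θd := lt_of_le_of_ne hθd (Ne.symm hθd0)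
        have hcn : IsNormalTo (n₁ ⨯₃ e) (u (n₁ + θc • e) t) := hgood θc ⟨hθcpos, hc⟩ (by linarith)
        have hdn : IsNormalTo (n₁ ⨯₃ e) (u (n₁ + θd • e) t) := hgood θd ⟨hθdpos, hd⟩ (by linarith)
        have hθcd : θc ≠ θd := by
          intro h; apply hcd; rw [h]
        exact nonInteracting_of_isNormalTo hk hθcd hcn hdn
      exact ⟨hNI, hn₁normal.transport hk hθmΘ.1.ne' (hgen n₁ h₁) (hgen _ hθmΘ.2)
        (hS.div_free _ hθmΘ.2 t ht) hNI⟩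
    exact (hall θ ⟨hθ, hp⟩).1

end IsFiniteModeEulerSolution

end KY

end Literature.Analysis.FluidPDE
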